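import Mathlib
import Literature.Analysis.FluidPDE.GaussianVortexPlanar
import Literature.Analysis.FluidPDE.GaussianVortexPlanarProofs
import HarnessLib

/-!
# Helper for stub `stub_coreInverse` (line `braid-closed-large-circulation-gluing`, crux stmt-AnomalousDissipation-3009):
# the angular derivative integrates to zero

`∫_{ℝ²} Dh(x)[x^⊥] dx = 0` for `h ∈ C¹(ℝ²)` with one moment: `|x| h` and `|x| ‖Dh‖` integrable
(`integral_fderiv_perp_eq_zero`). Since `x^⊥ = (−x₁, x₀)` is divergence free, `Dh[x^⊥] = div(h x^⊥)`; concretely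
`Dh(x)[x^⊥] = −x₁ ∂₀h + x₀ ∂₁h` and each term integrates to zero by one integration by parts on the whole plane
(Mathlib `integral_mul_fderiv_eq_neg_fderiv_mul_of_integrable`, the coordinate `x₁` having `∂₀x₁ = 0`).
This is the identity `∫ ∂_θ(·) = 0` behind the skew-symmetry of the angular derivative `∂_θ` in every radially weighted
`L²` space (`∫ ρ(|x|) u ∂_θu = ½∫ ∂_θ(ρ u²) = 0`), used twice in the energy method for `stub_coreInverse`: for the
skew-symmetry of `Λ_G` in `L²(G⁻¹)` (`∫ G Ω u ∂_θu = 0`) and for `⟨L w, ∂_θ w⟩_{L²(G⁻¹)} = 0`.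

References: Th. Gallay, C. E. Wayne, Comm. Math. Phys. 255 (2005) §4 (skew-symmetry of `Λ`); T. Li, D. Wei, Z. Zhang,
arXiv:1701.06269, Lemma 2.1.
-/

set_option linter.dupNamespace false

noncomputable section

open scoped RealInnerProductSpace Topology
open MeasureTheory WithLp Function

namespace Summit.AnomalousDissipation.AnomalousDissipation.Theorems.MarginalStabilityChainStretchedVortexRows

open Literature.Analysis.FluidPDE

/-- `x^⊥ = −x₁ e₀ + x₀ e₁`. [folklore] -/
theorem perp_eq_smul_single_add (x : EuclideanSpace ℝ (Fin 2)) :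
    perp x = (-x 1) • EuclideanSpace.single (0 : Fin 2) (1 : ℝ) + (x 0) • EuclideanSpace.single (1 : Fin 2) (1 : ℝ) := by
  ext i
  fin_cases i <;> simp [perp]

/-- `Dh(x)[x^⊥] = −x₁ ∂₀h(x) + x₀ ∂₁h(x)`. [folklore] -/
theorem fderiv_apply_perp (h : EuclideanSpace ℝ (Fin 2) → ℝ) (x : EuclideanSpace ℝ (Fin 2)) :
    fderiv ℝ h x (perp x) =
      -x 1 * fderiv ℝ h x (EuclideanSpace.single 0 1) + x 0 * fderiv ℝ h x (EuclideanSpace.single 1 1) := by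
  rw [perp_eq_smul_single_add, map_add, map_smul, map_smul, smul_eq_mul, smul_eq_mul]

/-- A coordinate against a partial derivative in ANOTHER direction integrates to zero:
`∫ x_j ∂ᵢh = −∫ (∂ᵢx_j) h = 0` for `i ≠ j` (`h ∈ C¹`, `|x| h` and `|x| ‖Dh‖` integrable). [folklore] -/
theorem integral_coord_mul_fderiv_single_eq_zero {h : EuclideanSpace ℝ (Fin 2) → ℝ} (hh : ContDiff ℝ 1 h)
    (h0 : Integrable fun x => ‖x‖ * h x) (h1 : Integrable fun x => ‖x‖ * ‖fderiv ℝ h x‖)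
    {i j : Fin 2} (hij : i ≠ j) :
    ∫ x : EuclideanSpace ℝ (Fin 2), x j * fderiv ℝ h x (EuclideanSpace.single i 1) = 0 := by
  -- the coordinate `x ↦ x j` is the continuous linear map `proj j`; its derivative in direction `e_i` is `0`
  have hcoord : ∀ x : EuclideanSpace ℝ (Fin 2),
      fderiv ℝ (fun y : EuclideanSpace ℝ (Fin 2) => y j) x (EuclideanSpace.single i 1) = 0 := by
    intro x
    rw [show (fun y : EuclideanSpace ℝ (Fin 2) => y j) =
        ⇑(EuclideanSpace.proj j : EuclideanSpace ℝ (Fin 2) →L[ℝ] ℝ) from rfl,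
      ContinuousLinearMap.fderiv]
    simp [hij.symm]
  have hmeas_d : AEStronglyMeasurable (fun x => fderiv ℝ h x (EuclideanSpace.single i 1)) volume :=
    ((hh.continuous_fderiv one_ne_zero).clm_apply continuous_const).aestronglyMeasurable
  have hxj : ∀ x : EuclideanSpace ℝ (Fin 2), |x j| ≤ ‖x‖ := fun x => by
    simpa [Real.norm_eq_abs] using (EuclideanSpace.norm_eq x ▸ PiLp.norm_apply_le x j)
  have key := integral_mul_fderiv_eq_neg_fderiv_mul_of_integrable (μ := volume)
    (f := fun y : EuclideanSpace ℝ (Fin 2) => y j) (g := h) (v := EuclideanSpace.single i 1) ?_ ?_ ?_ ?_ ?_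
  · rw [key]
    simp [hcoord]
  · simp only [hcoord, zero_mul]
    exact integrable_zero _ _ _
  · refine Integrable.mono' h1 ((continuous_apply j |>.comp (PiLp.continuous_ofLp 2 _)).aestronglyMeasurable.mul
      hmeas_d) (Filter.Eventually.of_forall fun x => ?_)
    rw [Real.norm_eq_abs, abs_mul]
    refine mul_le_mul (hxj x) ?_ (abs_nonneg _) (norm_nonneg _)
    calc |fderiv ℝ h x (EuclideanSpace.single i 1)| = ‖fderiv ℝ h x (EuclideanSpace.single i 1)‖ := rfl
      _ ≤ ‖fderiv ℝ h x‖ * ‖EuclideanSpace.single i (1:ℝ)‖ := ContinuousLinearMap.le_opNorm _ _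
      _ = ‖fderiv ℝ h x‖ := by simp
  · refine Integrable.mono' h0.norm ((continuous_apply j |>.comp (PiLp.continuous_ofLp 2 _)).aestronglyMeasurable.mul
      hh.continuous.aestronglyMeasurable) (Filter.Eventually.of_forall fun x => ?_)
    rw [Real.norm_eq_abs, abs_mul, Real.norm_eq_abs, abs_mul, abs_norm]
    exact mul_le_mul_of_nonneg_right (hxj x) (abs_nonneg _)
  · intro x _
    exact (EuclideanSpace.proj j : EuclideanSpace ℝ (Fin 2) →L[ℝ] ℝ).differentiableAt
  · intro x _
    exact hh.differentiable one_ne_zero x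

/-- **The angular derivative integrates to zero**: `∫_{ℝ²} Dh(x)[x^⊥] dx = 0` for `h ∈ C¹(ℝ²)` with `|x| h` and
`|x| ‖Dh‖` integrable (`x^⊥ = (−x₁, x₀)` is divergence free). [folklore] -/
theorem integral_fderiv_perp_eq_zero :
    ∀ h : EuclideanSpace ℝ (Fin 2) → ℝ, ContDiff ℝ 1 h → (Integrable fun x => ‖x‖ * h x) →
      (Integrable fun x => ‖x‖ * ‖fderiv ℝ h x‖) →
      ∫ x, fderiv ℝ h x (perp x) = 0 := by
  intro h hh h0 h1
  simp_rw [fderiv_apply_perp]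
  have hmeas_d : ∀ i : Fin 2, AEStronglyMeasurable (fun x => fderiv ℝ h x (EuclideanSpace.single i 1)) volume :=
    fun i => ((hh.continuous_fderiv one_ne_zero).clm_apply continuous_const).aestronglyMeasurable
  have hxj : ∀ (x : EuclideanSpace ℝ (Fin 2)) (j : Fin 2), |x j| ≤ ‖x‖ := fun x j => by
    simpa [Real.norm_eq_abs] using (EuclideanSpace.norm_eq x ▸ PiLp.norm_apply_le x j)
  have hint : ∀ i j : Fin 2, Integrable fun x : EuclideanSpace ℝ (Fin 2) =>
      x j * fderiv ℝ h x (EuclideanSpace.single i 1) := by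
    intro i j
    refine Integrable.mono' h1 ((continuous_apply j |>.comp (PiLp.continuous_ofLp 2 _)).aestronglyMeasurable.mul
      (hmeas_d i)) (Filter.Eventually.of_forall fun x => ?_)
    rw [Real.norm_eq_abs, abs_mul]
    refine mul_le_mul (hxj x j) ?_ (abs_nonneg _) (norm_nonneg _)
    calc |fderiv ℝ h x (EuclideanSpace.single i 1)| = ‖fderiv ℝ h x (EuclideanSpace.single i 1)‖ := rfl
      _ ≤ ‖fderiv ℝ h x‖ * ‖EuclideanSpace.single i (1:ℝ)‖ := ContinuousLinearMap.le_opNorm _ _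
      _ = ‖fderiv ℝ h x‖ := by simp
  have hA := integral_coord_mul_fderiv_single_eq_zero hh h0 h1 (i := 0) (j := 1) (by decide)
  have hB := integral_coord_mul_fderiv_single_eq_zero hh h0 h1 (i := 1) (j := 0) (by decide)
  rw [integral_add ((hint 0 1).neg.congr (Filter.Eventually.of_forall fun x => by simp [neg_mul])) (hint 1 0)]
  have hA' : ∫ x : EuclideanSpace ℝ (Fin 2), -x 1 * fderiv ℝ h x (EuclideanSpace.single 0 1) = 0 := by
    simp_rw [neg_mul, integral_neg, hA, neg_zero]
  rw [hA', hB, add_zero]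

end Summit.AnomalousDissipation.AnomalousDissipation.Theorems.MarginalStabilityChainStretchedVortexRows

end
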